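import Summits.CriticalPhenomena.PercolationContinuityZ3.Theorems.PercNearOneGluingNoHeavyLowerTailKnQuestion8CoefficientwiseCoreClassKernelMixBouquet
import Summits.CriticalPhenomena.PercolationContinuityZ3.Theorems.PercNearOneGluingNoHeavyLowerTailKnQuestion8CoefficientwiseCoreClassKernelMixTwoArmsProduct

/-!
# Two-arm gluing for the chordless two-type inequality, V: two-cycle bouquets (cycle words)

Support file (`--supports stmt-CriticalPhenomena-4575`, closed), prover `prim-cplus-coupling` (gen 71).  No definitions, no named
facts, no sorries; standard axioms.  Memo `prim-cplus-coupling/A5-COUPLING-gen71.md` §2; abstract theorem in `…KernelMixTwoArmsProduct`.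

* `TwoArms.x2_cycleWords` — the single-cycle CHORDED two-type inequality on the word lattice `Bool × Finset α × Bool` of a cycle with
  `|α| ≥ 1` interior edges (levels = `CycleWords.IsLevel`), i.e. `Bouquet.HBundle.x2` for the one-cycle bouquet `HBundle.unit.consCycle α`
  transported along `Unit × W ≃ W`: hypothesis (X2₁) of the two-arm theorem.
* `TwoArms.two_arms_cycles` — **THEOREM (the chordless two-type inequality for the bouquet of two cycles `C_{|α|+2} + C_{|β|+2}`)**:
  on `W_α × W_β` (product order, mirror `(cw, cw)`), for single-cycle levels `D_α, B_α, D_β, B_β` consistent at the corner, the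
  chordless levels `D = {⊥} × D_β ∪ D_α × {⊥}`, `B` likewise, demand region `G = {⊥} × (W_β∖⊤) ∪ (W_α∖⊤) × {⊥}` (one cycle fully blue,
  none fully red) and ALL upper families `A, C`:
  `#((A∖C)∩(D∖B)) + #((C∖A)∩(B∖D)) ≤ #((A∖C)∩c⁻¹D) + #((C∖A)∩c⁻¹B) + #(A∩C∩c⁻¹G) + #(A∩C∩(G∖(D∪B)))` —
  the `r = 2` case (all cycle lengths `≥ 3`) of the lane's chordless two-type conjecture (memo gen 70 §4, CONJECTURE JL / X2).
  (The typed-target filters are written `@Finset.filter _ p (fun _ => inferInstance) univ`: instance search does not find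
  `DecidablePred` for a pair-valued membership predicate under a binder, although it finds each `Decidable` instance.)
[cite: KozmaNitzan2024, Questions 8–9 (§5.5 p. 36) (context); Harris 1960; Kleitman 1966]
-/

namespace Summit.CriticalPhenomena.PercolationContinuityZ3.Theorems.Coefficientwise.TwoArms

open Finset Bouquet CycleWords CycleFactor ReducedKleitman HSpace

/-- **The single-cycle chorded two-type inequality on cycle words** (the one-cycle case of `Bouquet.HBundle.x2`, transported
from `Unit × W` to the word lattice `W = Bool × Finset α × Bool`): for levels `D, B` (`CycleWords.IsLevel`) and upper families
`A, C`,  `#((A∖C)∩(D∖B)) + #((C∖A)∩(B∖D)) ≤ #((A∖C)∩{cw ∈ D}) + #((C∖A)∩{cw ∈ B}) + #(A∩C∩(univ∖⊥)) + #(A∩C∩((univ∖⊤)∖(D∪B)))`.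
This is hypothesis (X2₁) of `two_arms_product` for a cycle of length `≥ 3`. -/
theorem x2_cycleWords {α : Type} [Fintype α] [DecidableEq α] [Nonempty α]
    (D B : Finset (Bool × Finset α × Bool)) (hD : IsLevel D) (hB : IsLevel B)
    (A C : Finset (Bool × Finset α × Bool)) (hA : IsUpperSet (A : Set (Bool × Finset α × Bool)))
    (hC : IsUpperSet (C : Set (Bool × Finset α × Bool))) :
    ((A \ C) ∩ (D \ B)).card + ((C \ A) ∩ (B \ D)).card ≤
      ((A \ C) ∩ univ.filter (fun x => cw x ∈ D)).card + ((C \ A) ∩ univ.filter (fun x => cw x ∈ B)).card +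
        (A ∩ C ∩ univ.erase (botW α)).card + (A ∩ C ∩ (univ.erase (topW α) \ (D ∪ B))).card := by
  classical
  set H : HBundle := HBundle.unit.consCycle α with hH
  let e : (Bool × Finset α × Bool) ↪ H.X := ⟨fun w => ((), w), fun w w' h => (Prod.mk.injEq _ _ _ _ ▸ h).2⟩
  have he : ∀ (S : Finset (Bool × Finset α × Bool)) (z : H.X), z ∈ S.map e ↔ z.2 ∈ S := by
    intro S z
    obtain ⟨u, w⟩ := z
    constructor
    · intro hz
      obtain ⟨a, ha, hz⟩ := mem_map.mp hz
      have : a = w := (Prod.mk.injEq _ _ _ _ ▸ hz).2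
      exact this ▸ ha
    · intro hw
      exact mem_map.mpr ⟨w, hw, by show ((), w) = (u, w); rfl⟩
  have hc2 : ∀ z : H.X, (H.c z).2 = cw z.2 := fun z => rfl
  have hNF : ∀ z : H.X, z ∈ H.NF ↔ z.2 ∈ univ.erase (topW α) := by
    intro z
    obtain ⟨u, w⟩ := z
    change (u, w) ∈ HBundle.unit.NF ×ˢ univ.erase (topW α) ↔ w ∈ univ.erase (topW α)
    exact ⟨fun h => (mem_product.mp h).2,
      fun h => mem_product.mpr ⟨show u ∈ ({()} : Finset Unit) from mem_singleton.mpr rfl, h⟩⟩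
  have hlev : ∀ S : Finset (Bool × Finset α × Bool), IsLevel S → H.Level (S.map e) := by
    intro S hS
    have hfib : ∀ x : Unit, fibL (S.map e) x = S := by
      intro x; ext w; exact mem_fibL.trans (he S (x, w))
    show (∀ x, IsLevel (fibL (S.map e) x)) ∧ (∀ v, HBundle.unit.Level (fibR (S.map e) v))
    exact ⟨fun x => by rw [hfib x]; exact hS, fun _ => trivial⟩
  have hup : ∀ S : Finset (Bool × Finset α × Bool), IsUpperSet (S : Set (Bool × Finset α × Bool)) →
      IsUpperSet ((S.map e : Finset H.X) : Set H.X) := by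
    intro S hS a b hab ha
    rw [mem_coe, he] at ha ⊢
    exact hS hab.2 ha
  have hNE : ∀ S : Finset (Bool × Finset α × Bool), IsLevel S →
      univ.filter (fun x : H.X => H.c x ∈ S.map e) ⊆ (univ.erase (botW α)).map e := by
    intro S hS z hz
    rw [he]
    have h := (mem_filter.mp hz).2
    rw [he, hc2] at h
    refine mem_erase.mpr ⟨fun hb => hS.2.1 ?_, mem_univ _⟩
    rw [hb, cw_botW] at h
    exact h
  have h := H.x2 (D.map e) (B.map e) (hlev D hD) (hlev B hB) ((univ.erase (botW α)).map e) (hNE D hD) (hNE B hB)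
    (A.map e) (C.map e) (hup A hA) (hup C hC)
  -- transport every term back along `e`
  have t1 : (A.map e \ C.map e) ∩ (D.map e \ B.map e) = ((A \ C) ∩ (D \ B)).map e := by
    ext z; simp only [mem_inter, mem_sdiff, he]
  have t2 : (C.map e \ A.map e) ∩ (B.map e \ D.map e) = ((C \ A) ∩ (B \ D)).map e := by
    ext z; simp only [mem_inter, mem_sdiff, he]
  have t3 : (A.map e \ C.map e) ∩ univ.filter (fun x : H.X => H.c x ∈ D.map e) =
      ((A \ C) ∩ univ.filter (fun x => cw x ∈ D)).map e := by
    ext z; simp only [mem_inter, mem_sdiff, mem_filter, mem_univ, true_and, he, hc2]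
  have t4 : (C.map e \ A.map e) ∩ univ.filter (fun x : H.X => H.c x ∈ B.map e) =
      ((C \ A) ∩ univ.filter (fun x => cw x ∈ B)).map e := by
    ext z; simp only [mem_inter, mem_sdiff, mem_filter, mem_univ, true_and, he, hc2]
  have t5 : A.map e ∩ C.map e ∩ (univ.erase (botW α)).map e = (A ∩ C ∩ univ.erase (botW α)).map e := by
    ext z; simp only [mem_inter, he]
  have t6 : A.map e ∩ C.map e ∩ (H.NF \ (D.map e ∪ B.map e)) = (A ∩ C ∩ (univ.erase (topW α) \ (D ∪ B))).map e := by
    ext z; simp only [mem_inter, mem_sdiff, mem_union, he, hNF]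
  rw [t1, t2, t3, t4, t5, t6, card_map, card_map, card_map, card_map, card_map, card_map] at h
  exact h

/-- **THEOREM (chordless two-type inequality for the bouquet of two cycles).**  For cycles with interior edge types `α, β`
(nonempty: lengths `≥ 3`), single-cycle levels `Dα, Bα, Dβ, Bβ` (`CycleWords.IsLevel`) consistent at the corner
(`⊥ ∈ Dα ↔ ⊥ ∈ Dβ`, `⊥ ∈ Bα ↔ ⊥ ∈ Bβ`), the chordless levels `D = {⊥}×Dβ ∪ Dα×{⊥}`, `B = {⊥}×Bβ ∪ Bα×{⊥}` and demand region
`G = {⊥}×(univ∖⊤) ∪ (univ∖⊤)×{⊥}` on `W_α × W_β`, and all upper families `A, C`: the two-type inequality (X2) with typed targets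
`c⁻¹D, c⁻¹B`, supply `c⁻¹G` and pool `G∖(D∪B)`, `c = (cw, cw)`.  Memo gen 71 §2 (`two_arms_product` + `x2_cycleWords`). -/
theorem two_arms_cycles {α β : Type} [Fintype α] [DecidableEq α] [Nonempty α] [Fintype β] [DecidableEq β] [Nonempty β]
    (Dα Bα : Finset (Bool × Finset α × Bool)) (Dβ Bβ : Finset (Bool × Finset β × Bool))
    (hDα : IsLevel Dα) (hBα : IsLevel Bα) (hDβ : IsLevel Dβ) (hBβ : IsLevel Bβ)
    (hDc : botW α ∈ Dα ↔ botW β ∈ Dβ) (hBc : botW α ∈ Bα ↔ botW β ∈ Bβ)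
    (Dz Bz Gz : Finset ((Bool × Finset α × Bool) × (Bool × Finset β × Bool)))
    (hDz : Dz = Dβ.image (fun q => (botW α, q)) ∪ Dα.image (fun p => (p, botW β)))
    (hBz : Bz = Bβ.image (fun q => (botW α, q)) ∪ Bα.image (fun p => (p, botW β)))
    (hGz : Gz = (univ.erase (topW β)).image (fun q => (botW α, q)) ∪ (univ.erase (topW α)).image (fun p => (p, botW β)))
    (A C : Finset ((Bool × Finset α × Bool) × (Bool × Finset β × Bool)))
    (hA : IsUpperSet (A : Set ((Bool × Finset α × Bool) × (Bool × Finset β × Bool))))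
    (hC : IsUpperSet (C : Set ((Bool × Finset α × Bool) × (Bool × Finset β × Bool)))) :
    ((A \ C) ∩ (Dz \ Bz)).card + ((C \ A) ∩ (Bz \ Dz)).card ≤
      ((A \ C) ∩ @Finset.filter _ (fun z : (Bool × Finset α × Bool) × (Bool × Finset β × Bool) => (cw z.1, cw z.2) ∈ Dz) (fun _ => inferInstance) univ).card +
          ((C \ A) ∩ @Finset.filter _ (fun z : (Bool × Finset α × Bool) × (Bool × Finset β × Bool) => (cw z.1, cw z.2) ∈ Bz) (fun _ => inferInstance) univ).card +
        (A ∩ C ∩ @Finset.filter _ (fun z : (Bool × Finset α × Bool) × (Bool × Finset β × Bool) => (cw z.1, cw z.2) ∈ Gz) (fun _ => inferInstance) univ).card +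
        (A ∩ C ∩ (Gz \ (Dz ∪ Bz))).card :=
  two_arms_product (botW α) (topW α) cw Dα Bα botW_le le_topW botW_ne_topW cw_cw cw_botW hDα.1 hBα.1 hDα.2.1 hBα.2.1
    (fun A' C' hA' hC' => x2_cycleWords Dα Bα hDα hBα A' C' hA' hC')
    (botW β) (topW β) cw Dβ Bβ botW_le le_topW botW_ne_topW cw_cw cw_botW hDβ.2.1 hBβ.2.1
    (fun A' C' hA' hC' => x2_cycleWords Dβ Bβ hDβ hBβ A' C' hA' hC')
    hDc hBc Dz Bz Gz hDz hBz hGz A C hA hC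

end Summit.CriticalPhenomena.PercolationContinuityZ3.Theorems.Coefficientwise.TwoArms
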